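import Literature.MathematicalPhysics.QuantumFieldTheory.Balaban1983to89.Node00.Record12BgRowCoDiv
import Literature.MathematicalPhysics.QuantumFieldTheory.Balaban1983to89.Node00.CriticalOfRecord

/-!
# NODE 00 — ROW P11: «U IS A CRITICAL CONFIGURATION OF (5) ON THE FIBRE 𝔅(𝐁, W)» (holes currency), THE SILENT STEP «MINIMAL ⇒ CRITICAL»
# OVER PRINT'S CLASS (6) = (1.7) ∧ (1.9) PROVED, AND [15] PROPOSITION 8 p. 304 AS THE NAMED FACT THE RE-KEYED THEOREM-1 SENTENCE REDUCES TO

Cell `pub-ymgap`, seat `pub-ymgap-dag-n07-e` generation 8 (R141 (C), DAG node N07 = [15] = [Balaban1985Variational]; INBOX INTENT-20 of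
2026-08-27 ≈08:05Z; node00-def-P11 g2 NO-STOP l.17844).  NEW leaf; def-P11's FILE 9 `Node00.Record12BgRowCoDiv` (p509206) and this seat's g2
`Node00.CriticalOfRecord` (p464601) CONSUMED BY NAME, nothing modified.  `--kind definition --supports stmt-QuantumFields-20289` (K0⁗; count-neutral bookkeeping + one definition of
record + one named fact, never asserted).  [6] = [Balaban1985RegularSpaces]; [III] = [Balaban1988Convergent].

PRINT.  [15] p. 278: the variational problem (5)–(6) «find the minimum of U ↦ A(U) over the space (6)», (6) = `𝔘_k({Ω_j}, ε₀) ∩ 𝔅_k(𝔅_k, V)` with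
`𝔘_k({Ω_j}, ε₀)` the REGULAR SPACE of [6] (1.7)–(1.9): «|U(∂p) − 1| < ε₀L^{−2j} for p ∈ Ω_j» (1.7) AND «|(D^{η*}_U ∂U)(b)| < ε₀L^{−2j}(L^jη)^{−1} for b ∈ Ω_j»
(1.9), and `𝔅_k(𝔅_k, V)` the fibre «Ū^j = V on Λ_j, j = 0, …, k» of the determining set ([III] (2.10)–(2.12)); p. 304 [28], PROPOSITION 8, verbatim:
*«There exists a positive, absolute constant a₅ such, that if U is a critical configuration of (5) in the space (6) with V satisfying (7), and if
ε₀ ≦ a₅, then U belongs to the space (8).»* — (8) = `𝔘_k({Ω_j}, B₃ε₁) ∩ 𝔅_k(𝔅_k, V)`; p. 300 [24] (Sect. F): *«We will use only the fact that they are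
critical configurations of the functional (5) and that they belong to the spaces (6) with ε₀ sufficiently small.»*  The step from «minimal» (what
Theorem 1 (8) and the K0 row of record speak about) to «critical» (what Prop. 8 consumes) is SILENT in print: a minimiser of a differentiable function
over an OPEN subset of the constraint set has vanishing derivative along every differentiable curve in the constraint set through it.

WHY NOW (director-ym LINE №149 (1), INBOX l.17673, 2026-08-27 07:44Z): «print proves (1.9)-regularity only for critical points IN (6) = (1.7)∧(1.9)»;
№150 (l.17700): the class edition (node00-def-R `regMSCoOfRecord` ∕ `UbgMSCoOfRecord` = print's class (6) and minimiser over it) and the [15] fact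
RE-KEYED to the primed class («a MINIMISER of (2.12) over (6) at (7)-data lies in (8)», def-P11 FILE 10 `VariationalThm1RegSepCo6`).  AT THE OBJECTS
OF RECORD THAT SENTENCE IS PROP. 8 ∘ FERMAT, and Fermat is a theorem here (§2).  Hence, after the class edition, the [15] content the K0 row displays is
PROPOSITION 8 ALONE — no Props 2–7 (existence), no Prop. 9 (uniqueness), no «minimal» reading.

WHAT THIS FILE DOES.
* §1 ★ `IsCritOnFibre F N K 𝐁 W U` — «U is a critical configuration of (5) on the fibre of the determining set `𝐁` at the multi-scale datum `W`»,
  in the curve form of this seat's g2 `IsCritOfRecord` (one scale) transplanted to [III]'s fibres `{U | AgreeOn 𝐁 (avgFamily av U) W}` (every scale):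
  along EVERY curve `γ` through `U` at `t = 0`, differentiable at `0` as a curve of bond matrices, lying in the fibre for `t` near `0`, every derivative
  at `0` of `t ↦ A(γ t)` is `0`.  `isCritOnFibre_iff_hasDerivAt_zero` (the derivative EXISTS, g2 §2b, so the predicate is «(A ∘ γ)′(0) = 0»);
  `isCritOnFibre_atScale_iff` (on the one-scale determining set `atScale k` it IS g2's `IsCritOfRecord F N K k (W k) U` — consistency of the two pins);
  `isCritOnFibre_of_wilsonAction4_eq_zero` (every zero-action configuration is critical on every fibre through it: genuine, not vacuous).
* §2 THE FERMAT STEP ON A FIBRE, and CURVE-OPENNESS OF (1.7) AND OF (6) = (1.7) ∧ (1.9): `deriv_wilsonAction4_eq_zero_of_isMinimizer` (generic: any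
  torus, group, averaging family, class, determining set); `eventually_plaqSmallOn` ((1.7) on any plaquette set is finitely many STRICT inequalities
  between continuous functions of the bond matrices), `continuous_coDivSum` + `eventually_coDivSmallOn` (so is (1.9): def-P11's `Sect2.coDivSum` is a
  polynomial in the bond matrices and their inverses), `eventually_mem_class17`, `eventually_mem_class6`; ★ `isCritOnFibre_of_isMinimizer_class17`
  (a minimiser of (2.12) over the (1.7)-class — def-R's `regMSOfRecord` reading — is critical on the fibre), ★ `isCritOnFibre_of_isMinimizer_class6`
  (the same over print's class (6)), `isCritOnFibre_of_isMinimizer_of_coDivClassOn` (FILE 9's hypothesis pair: (1.7)-minimiser + (1.9)-member).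
* §3 ★★ THE NAMED FACT `Prop8RegSepPrinted F N B₃ a₀ a₁` — [15] Prop. 8 p. 304 at the objects of record, in FILE 8 v1.3 ∕ FILE 9 ∕ FILE 10's currency
  WITH THE COMPARABILITY READ BOTH WAYS (C′: `δ_n ≤ 2δ_{n+1}` AND `δ_{n+1} ≤ 2δ_n`) — separated (2.18) index, data with print's (7) on the CONCORD range
  `Sect2.DataSmall7P`: every configuration of the class (6) at `ε₀` ON THE FIBRE of `W` that is a critical configuration of (5) on that fibre lies in
  (8) — (1.7) at `B₃δ_n·η_n²` and (1.9) at `B₃δ_n·η_n³`; a `Prop`, NEVER asserted; `Prop8RegSepPrinted.of_le`.  ★★ `regular_of_isMinimizer_class6_of_prop8`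
  — THE PRIMED-CLASS THEOREM-1 SENTENCE of №149∕№150 (minimiser over the class-(6) literal of FILE 10's `VariationalThm1RegSepCo6` on `genSet s.Ω k` at
  (7)-data ⇒ (8)) FROM PROP. 8, in the C′ block; ★ `regular_of_isMinimizer_class17_of_coDivClassOn_of_prop8` (FILE 9's hypothesis pair) and
  `regular_UbgMSOfRecord_of_prop8` (def-R's background of record, FILE 9's supplier shape + `hcomp'`).

LOCATED-M4 «FREE δ₀» (this seat, INBOX 2026-08-27 ≈08:40Z; why §3 carries C′ and does NOT derive FILES 8–10's facts): over the ONE-SIDED block of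
`VariationalThm1RegSepPrinted` ∕ `…PrintedCo` ∕ `…Co6` the conclusion at `n = 0` — all fine plaquettes `< B₃δ₀`, `omegaPlaqs … 0 = univ` — meets a `δ₀`
bounded from above only and read by `DataSmall7P` on the PINNED level-0 plaquettes only; a datum trivial at level 0 and twisted at level 1 inside `Ω₁`
(one interior fine bond, `k = 1`) has an open-class minimiser (this seat's 19a `exists_isMinimizer_holes_of_smallAction`) whose pinned coarse plaquette is
non-trivial, so `δ₀ ↓ 0` refutes all three for EVERY `B₃` — a MISSTATED-class defect whose repair is C′ (kernel certificate: a successor module on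
dag-n21-c's single-bond average).  Print's uniform `ε₁` is untouched.

READING DISPLAYED (ref-C READ-121 NOTE 2, unchanged): criticality is pinned in the CURVE form; print's Sect. F consumes the (82) tangent form
(`B11Eq81Expansion`); the two agree where the averaging of record is a submersion at `U` (regular-value step) — a future discharge of `Prop8RegSepPrinted`
from print's pp. 300–304 owes «curve-critical ⇒ (82)-critical», GAP-STATED(submersion).  The (1.7)-ONLY minimiser fact `VariationalThm1RegSepPrinted`
(FILE 8 §7) is NOT reachable from print's Prop. 8 (its minimiser need not lie in (6)) — exactly №149 (1).

HONEST FRAMING: one definition of record + kernel bookkeeping + one elementary real-analysis step (Fermat) + one named fact never asserted; NO estimate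
of [15] proved; Prop. 8 itself (T3, Sect. F) NOT claimed; N07 ∕ K0⁗ NOT discharged; counts unmoved (5∕27); one finite T⁴ programme at fixed ε — NOT
continuum ∕ ℝ⁴ ∕ OS ∕ mass gap ∕ Clay.  No `sorry`, no `axiom`, no `instance`, no `notation`.
-/

noncomputable section

namespace Literature.MathematicalPhysics.QuantumFieldTheory.Balaban1983to89.Node00

open Filter Topology
open T4Continuum (T4Family)
open B15DeterminingSets
open scoped Matrix.Norms.L2Operator

/-! ## §1 The criticality predicate on a fibre -/

section Critical

variable (F : T4Family) (N : ℕ) [NeZero N]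

/-- ★ **«U IS A CRITICAL CONFIGURATION OF THE FUNCTIONAL (5) ON THE FIBRE 𝔅(𝐁, W)»** at NODE 00's objects (`SU(N)`, the `K`-th torus of the family,
the averaging of record), for a determining set `𝐁 = {Γ_j}` ([III] (2.2)) and a multi-scale datum `W` ((2.10)): along every curve
`γ : ℝ → GaugeField (F.P K) 0 (SU N)` with `γ 0 = U`, differentiable at `0` as a curve of bond matrices (`M_N(ℂ)`, operator norm), and lying in the
fibre `{U | AgreeOn 𝐁 (avgFamily av U) W}` («Ū^j = W_j on Λ_j for every j») for all `t` near `0`, every derivative at `0` of `t ↦ A(γ t)` is `0` — the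
curve form of «the differential of `A` restricted to the constraint set vanishes at `U`».  The class (6) does NOT enter (print's notion; (6) is open, §2).
The notion Prop. 8 and Sect. F take as HYPOTHESIS. [cite: Balaban1985Variational, (5)–(6) p.278, Prop. 8 p.304, Sect. F p.300; Balaban1988Convergent, (2.10)–(2.12) p.256] -/
def IsCritOnFibre (K : ℕ) (𝔹 : DetSet (F.P K)) (W : MSField (F.P K) (SU N)) (U : GaugeField (F.P K) 0 (SU N)) : Prop :=
  ∀ γ : ℝ → GaugeField (F.P K) 0 (SU N), γ 0 = U →
    DifferentiableAt ℝ (fun (t : ℝ) (b : PBond (F.P K) 0) => ((γ t b : SU N) : Matrix (Fin N) (Fin N) ℂ)) 0 →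
      (∀ᶠ t in 𝓝 0, AgreeOn 𝔹 (avgFamily (avOfRecord F N K) (γ t)) W) →
        ∀ a : ℝ, HasDerivAt (fun t => wilsonAction4 (γ t)) a 0 → a = 0

variable {F N}

/-- **THE PREDICATE IS THE USUAL «(A ∘ γ)′(0) = 0»**: the derivative of the action along every curve differentiable as a curve of bond matrices
EXISTS (g2 `differentiableAt_wilsonAction4_along`), so `IsCritOnFibre` says exactly that it vanishes along every curve in the fibre.
[cite: Balaban1985Variational, (5)–(6) p.278, Prop. 8 p.304 («critical configuration of (5)»)] -/
theorem isCritOnFibre_iff_hasDerivAt_zero {K : ℕ} {𝔹 : DetSet (F.P K)} {W : MSField (F.P K) (SU N)} {U : GaugeField (F.P K) 0 (SU N)} :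
    IsCritOnFibre F N K 𝔹 W U ↔
      ∀ γ : ℝ → GaugeField (F.P K) 0 (SU N), γ 0 = U →
        DifferentiableAt ℝ (fun (t : ℝ) (b : PBond (F.P K) 0) => ((γ t b : SU N) : Matrix (Fin N) (Fin N) ℂ)) 0 →
          (∀ᶠ t in 𝓝 0, AgreeOn 𝔹 (avgFamily (avOfRecord F N K) (γ t)) W) → HasDerivAt (fun t => wilsonAction4 (γ t)) 0 0 := by
  refine ⟨fun h γ h0 hd hc => ?_, fun h γ h0 hd hc a ha => ha.unique (h γ h0 hd hc)⟩
  have hD := (differentiableAt_wilsonAction4_along hd).hasDerivAt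
  rwa [h γ h0 hd hc _ hD] at hD

/-- **CONSISTENCY WITH THE ONE-SCALE PIN**: on the one-scale determining set `atScale k` («everything at scale `k`», [I] (0.21)) the fibre of `W` is
`𝔅_k(W_k) = {U | Ū^k = W_k}` (`agreeOn_atScale_iff`), so criticality on that fibre IS this seat's g2 predicate `IsCritOfRecord F N K k (W k) U`
(«critical configuration of (5) on 𝔅_k(V)», no holes). [cite: Balaban1985Variational, (3),(5)–(6) p.278; Balaban1988Convergent, (2.12) p.256] -/
theorem isCritOnFibre_atScale_iff {K : ℕ} (k : ℕ) (W : MSField (F.P K) (SU N)) (U : GaugeField (F.P K) 0 (SU N)) :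
    IsCritOnFibre F N K (atScale k) W U ↔ IsCritOfRecord F N K k (W k) U := by
  simp only [IsCritOnFibre, IsCritOfRecord, agreeOn_atScale_iff, avgFamily]

/-- **NON-VACUITY**: a configuration of ZERO Wilson action (e.g. the flat one) is a critical configuration of (5) on EVERY fibre through it — along
any curve the action has a global minimum at `t = 0` (`A ≥ 0`), so its derivative there vanishes (Fermat); no constraint and no class is used.
[cite: Balaban1985Variational, (5) p.278 (A ≥ 0); Balaban1987RG1, (0.2) p.252] -/
theorem isCritOnFibre_of_wilsonAction4_eq_zero {K : ℕ} {𝔹 : DetSet (F.P K)} {W : MSField (F.P K) (SU N)} {U : GaugeField (F.P K) 0 (SU N)}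
    (hA : wilsonAction4 U = 0) : IsCritOnFibre F N K 𝔹 W U := by
  intro γ h0 _ _ a ha
  refine IsLocalMin.hasDerivAt_eq_zero ?_ ha
  refine Filter.Eventually.of_forall fun t => ?_
  show wilsonAction4 (γ 0) ≤ wilsonAction4 (γ t)
  rw [h0, hA]
  exact wilsonAction4_nonneg _

end Critical

/-! ## §2 The Fermat step on a fibre; curve-openness of (1.7) and of print's class (6) = (1.7) ∧ (1.9) -/

section Fermat

variable {P : Params} {G : Type*} [GaugeGroup G]

/-- **THE FERMAT STEP ON A FIBRE** (generic: any torus `P`, gauge group `G`, averaging family `av`, class `reg`, determining set `𝐁`).  If `U`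
minimises the Wilson action (5) over `reg` on the fibre of `W` (the tree's `IsMinimizer av reg 𝐁 W U`, [III] (2.12)) and `γ` is a curve of configurations
with `γ t₀ = U` which, for parameters near `t₀`, stays in `reg` and in the fibre, then `t ↦ A(γ t)` has a local minimum at `t₀`, so its derivative there —
whenever it exists — is `0`. [cite: Balaban1985Variational, (5)–(6) p.278, p.299 (before (141)), p.300 (Sect. F, first paragraph); Balaban1988Convergent, (2.12) p.256] -/
theorem deriv_wilsonAction4_eq_zero_of_isMinimizer {av : ∀ j, Averaging P j G} {reg : Set (GaugeField P 0 G)} {𝔹 : DetSet P}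
    {W : MSField P G} {U : GaugeField P 0 G} (h : IsMinimizer av reg 𝔹 W U)
    {γ : ℝ → GaugeField P 0 G} {t₀ : ℝ} (h0 : γ t₀ = U) (hreg : ∀ᶠ t in 𝓝 t₀, γ t ∈ reg)
    (hcons : ∀ᶠ t in 𝓝 t₀, AgreeOn 𝔹 (avgFamily av (γ t)) W) {a : ℝ}
    (ha : HasDerivAt (fun t => wilsonAction4 (γ t)) a t₀) : a = 0 := by
  refine IsLocalMin.hasDerivAt_eq_zero ?_ ha
  show ∀ᶠ t in 𝓝 t₀, wilsonAction4 (γ t₀) ≤ wilsonAction4 (γ t)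
  filter_upwards [hreg, hcons] with t ht hc
  rw [h0]
  exact h.2.2 (γ t) ht hc

end Fermat

section Openness

variable {P : Params} {N : ℕ} [NeZero N] {j : ℕ}

/-- `|· − 1|` (operator norm) is continuous on `SU(N)` (private copy of `B12ContinuousTransportInvarianceOn.continuous_dist1_SU`, not to import that chain). [folklore] -/
private theorem continuous_dist1_SU' : Continuous (dist1 : SU N → ℝ) :=
  UnitaryModel.continuous_opDist1.comp (Literature.MathematicalPhysics.QuantumLattice.continuous_fundamentalRep (Fin N))

/-- Plaquette variables are continuous in the configuration (private copy of `B12ContinuousTransportInvarianceOn.continuous_plaqHol_SU`). [folklore] -/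
private theorem continuous_plaqHol' (p : Plaq P j) : Continuous fun U : PBond P j → SU N => GaugeField.plaqHol U p := by
  have hb : ∀ b : PBond P j, Continuous fun U : PBond P j → SU N => U b := fun b => continuous_apply b
  unfold GaugeField.plaqHol
  exact (((hb _).mul (hb _)).mul (hb _).inv).mul (hb _).inv

/-- **CURVE-OPENNESS OF (1.7) ON ANY PLAQUETTE SET**: if a configuration-valued map `γ` is continuous at `x₀` (Pi topology of the bond matrices) and
`|γ x₀ (∂p) − 1| < δ` for `p ∈ S`, then the same holds for `γ x`, `x` near `x₀` — finitely many STRICT inequalities between continuous functions.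
[cite: Balaban1985RegularSpaces, (1.7) p.77 (strict); Balaban1985Variational, (2),(6) p.278] -/
theorem eventually_plaqSmallOn {X : Type*} [TopologicalSpace X] {S : Set (Plaq P j)} {δ : ℝ} {γ : X → GaugeField P j (SU N)} {x₀ : X}
    (hγ : ContinuousAt (fun x (b : PBond P j) => γ x b) x₀) (h : PlaqSmallOn S δ (γ x₀)) :
    ∀ᶠ x in 𝓝 x₀, PlaqSmallOn S δ (γ x) := by
  have hq : ∀ q : Plaq P j, q ∈ S → ∀ᶠ x in 𝓝 x₀, dist1 (GaugeField.plaqHol (γ x) q) < δ := by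
    intro q hq
    have hc : ContinuousAt (fun x => dist1 (GaugeField.plaqHol (γ x) q)) x₀ :=
      ((continuous_dist1_SU'.comp (continuous_plaqHol' q)).continuousAt).comp hγ
    exact hc.eventually_lt continuousAt_const (h q hq)
  have hall : ∀ q : Plaq P j, ∀ᶠ x in 𝓝 x₀, q ∈ S → dist1 (GaugeField.plaqHol (γ x) q) < δ := by
    intro q
    by_cases hqS : q ∈ S
    · exact (hq q hqS).mono fun x hx _ => hx
    · exact Filter.Eventually.of_forall fun x h' => absurd h' hqS
  exact (eventually_all.2 hall).mono fun x hx q hqS => hx q hqS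

omit [NeZero N] in
/-- The embedded bond matrix `U(b) ∈ M_N(ℂ)` (through r11's `ιSU`) is a continuous function of the configuration. [folklore] -/
private theorem continuous_coe_ιSU_apply (b : PBond P j) :
    Continuous fun U : PBond P j → SU N => ((ιSU N (U b) : (MatA N)ˣ) : MatA N) := by
  simp only [coe_ιSU]
  exact continuous_subtype_val.comp (continuous_apply b)

omit [NeZero N] in
/-- The embedded inverse bond matrix `U(b)⁻¹ ∈ M_N(ℂ)` is a continuous function of the configuration. [folklore] -/
private theorem continuous_coe_ιSU_inv_apply (b : PBond P j) :
    Continuous fun U : PBond P j → SU N => ((ιSU N (U b)⁻¹ : (MatA N)ˣ) : MatA N) := by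
  simp only [coe_ιSU]
  exact continuous_subtype_val.comp (continuous_apply b).inv

/-- The embedded plaquette matrix `(∂U)(p_{μν}(x)) ∈ M_N(ℂ)` (def-P11's `Sect2.plaqMat`) is continuous in the configuration. [cite: Balaban1985RegularSpaces, (1.2) p.76 (bookkeeping)] -/
private theorem continuous_plaqMat (x : Site P j) (μ ν : Fin P.d) (hμν : μ < ν) :
    Continuous fun U : PBond P j → SU N => Sect2.plaqMat U x μ ν hμν := by
  unfold Sect2.plaqMat
  simp only [coe_ιSU]
  exact continuous_subtype_val.comp (continuous_plaqHol' _)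

/-- One term `R(U(x, x−e_ν))F_{αβ}(x−e_ν) − F_{αβ}(x)` of (1.2) (def-P11's `Sect2.coDivTerm`) is continuous in the configuration. [cite: Balaban1985RegularSpaces, (1.1)–(1.2) p.76 (bookkeeping)] -/
private theorem continuous_coDivTerm (x : Site P j) (ν α β : Fin P.d) (hαβ : α < β) :
    Continuous fun U : PBond P j → SU N => Sect2.coDivTerm U x ν α β hαβ := by
  have h1 := continuous_coe_ιSU_inv_apply (P := P) (N := N) (j := j) ⟨x.unshift ν, ν⟩
  have h2 := continuous_coe_ιSU_apply (P := P) (N := N) (j := j) ⟨x.unshift ν, ν⟩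
  have h3 := continuous_plaqMat (P := P) (N := N) (x.unshift ν) α β hαβ
  have h4 := continuous_plaqMat (P := P) (N := N) x α β hαβ
  unfold Sect2.coDivTerm
  exact ((h1.mul h3).mul h2).sub h4

/-- **THE CO-DIVERGENCE `η·(D^{η*}_U ∂U)(x, x+e_μ)` OF (1.2) IS A CONTINUOUS FUNCTION OF THE CONFIGURATION** (def-P11's `Sect2.coDivSum`: a finite sum
of products of bond matrices, plaquette matrices and their inverses in `M_N(ℂ)`). [cite: Balaban1985RegularSpaces, (1.1)–(1.2) p.76, (1.9) p.77] -/
theorem continuous_coDivSum (x : Site P j) (μ : Fin P.d) :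
    Continuous fun U : PBond P j → SU N => Sect2.coDivSum U x μ := by
  unfold Sect2.coDivSum
  refine continuous_finsetSum _ fun ν _ => ?_
  by_cases h1 : ν < μ
  · simp only [dif_pos h1]
    exact continuous_coDivTerm x ν ν μ h1
  · by_cases h2 : μ < ν
    · simp only [dif_neg h1, dif_pos h2]
      exact (continuous_coDivTerm x ν μ ν h2).neg
    · simp only [dif_neg h1, dif_neg h2]
      exact continuous_const

/-- **CURVE-OPENNESS OF (1.9) ON ANY BOND SET**: if `γ` is continuous at `x₀` and `‖η·(D^{η*}_U∂U)(b)‖ < δ` on `S` at `γ x₀`, then the same holds at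
`γ x`, `x` near `x₀` — finitely many STRICT inequalities between continuous functions. [cite: Balaban1985RegularSpaces, (1.9) p.77 (strict); Balaban1985Variational, (2),(6) p.278] -/
theorem eventually_coDivSmallOn {X : Type*} [TopologicalSpace X] {S : Set (PBond P j)} {δ : ℝ} {γ : X → GaugeField P j (SU N)} {x₀ : X}
    (hγ : ContinuousAt (fun x (b : PBond P j) => γ x b) x₀) (h : Sect2.CoDivSmallOn S δ (γ x₀)) :
    ∀ᶠ x in 𝓝 x₀, Sect2.CoDivSmallOn S δ (γ x) := by
  have hb : ∀ b : PBond P j, b ∈ S → ∀ᶠ x in 𝓝 x₀, ‖Sect2.coDivSum (γ x) b.src b.dir‖ < δ := by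
    intro b hbS
    have hc : ContinuousAt (fun x => ‖Sect2.coDivSum (γ x) b.src b.dir‖) x₀ :=
      ((continuous_coDivSum b.src b.dir).continuousAt.comp hγ).norm
    exact hc.eventually_lt continuousAt_const (h b hbS)
  have hall : ∀ b : PBond P j, ∀ᶠ x in 𝓝 x₀, b ∈ S → ‖Sect2.coDivSum (γ x) b.src b.dir‖ < δ := by
    intro b
    by_cases hbS : b ∈ S
    · exact (hb b hbS).mono fun x hx _ => hx
    · exact Filter.Eventually.of_forall fun x h' => absurd h' hbS
  exact (eventually_all.2 hall).mono fun x hx b hbS => hx b hbS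

/-- **CURVE-OPENNESS OF THE (1.7)-CLASS `U_k({Ω_j}, ·)`** (def-R's `regMSOfRecord` reading, any thresholds `r_n`, any regions): a map continuous at `x₀`
with value in `{U | ∀ n ≤ k, |U(∂p) − 1| < r_n on omegaPlaqs Ω n}` there takes values in that class near `x₀`.
[cite: Balaban1985RegularSpaces, (1.7) p.77; Balaban1985Variational, (6) p.278] -/
theorem eventually_mem_class17 {X : Type*} [TopologicalSpace X] {Ω : ℕ → Set (Site P 0)} {k : ℕ} {r : ℕ → ℝ}
    {γ : X → GaugeField P 0 (SU N)} {x₀ : X} (hγ : ContinuousAt (fun x (b : PBond P 0) => γ x b) x₀)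
    (h : ∀ n, n ≤ k → PlaqSmallOn (omegaPlaqs Ω n) (r n) (γ x₀)) :
    ∀ᶠ x in 𝓝 x₀, ∀ n, n ≤ k → PlaqSmallOn (omegaPlaqs Ω n) (r n) (γ x) := by
  have hfin : ∀ i : Fin (k + 1), ∀ᶠ x in 𝓝 x₀, PlaqSmallOn (omegaPlaqs Ω (i : ℕ)) (r i) (γ x) :=
    fun i => eventually_plaqSmallOn hγ (h i (Nat.lt_succ_iff.mp i.2))
  exact (eventually_all.2 hfin).mono fun x hx n hn => hx ⟨n, Nat.lt_succ_of_le hn⟩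

/-- **CURVE-OPENNESS OF THE (1.9)-HALF** (def-P11's `Sect2.CoDivClassOn Ω k ε`): a map continuous at `x₀` with value satisfying (1.9) at `ε` there
satisfies it near `x₀`. [cite: Balaban1985RegularSpaces, (1.9) p.77; Balaban1985Variational, (6) p.278] -/
theorem eventually_coDivClassOn {X : Type*} [TopologicalSpace X] {Ω : ℕ → Set (Site P 0)} {k : ℕ} {ε : ℝ}
    {γ : X → GaugeField P 0 (SU N)} {x₀ : X} (hγ : ContinuousAt (fun x (b : PBond P 0) => γ x b) x₀)
    (h : Sect2.CoDivClassOn Ω k ε (γ x₀)) : ∀ᶠ x in 𝓝 x₀, Sect2.CoDivClassOn Ω k ε (γ x) := by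
  have hfin : ∀ i : Fin (k + 1), ∀ᶠ x in 𝓝 x₀, Sect2.CoDivSmallOn (Sect2.omegaBonds Ω (i : ℕ)) (ε * P.eta i ^ 3) (γ x) :=
    fun i => eventually_coDivSmallOn hγ (h i (Nat.lt_succ_iff.mp i.2))
  exact (eventually_all.2 hfin).mono fun x hx n hn => hx ⟨n, Nat.lt_succ_of_le hn⟩

/-- **CURVE-OPENNESS OF PRINT'S CLASS (6) = (1.7) ∧ (1.9)** (node00-def-R's class edition `regMSCoOfRecord`, director-ym №149 (3), read as the
literal `{U | (∀ n ≤ k, PlaqSmallOn (omegaPlaqs Ω n) (r n) U) ∧ Sect2.CoDivClassOn Ω k ε U}`). [cite: Balaban1985RegularSpaces, (1.7)–(1.9) p.77; Balaban1985Variational, (6) p.278] -/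
theorem eventually_mem_class6 {X : Type*} [TopologicalSpace X] {Ω : ℕ → Set (Site P 0)} {k : ℕ} {r : ℕ → ℝ} {ε : ℝ}
    {γ : X → GaugeField P 0 (SU N)} {x₀ : X} (hγ : ContinuousAt (fun x (b : PBond P 0) => γ x b) x₀)
    (h : (∀ n, n ≤ k → PlaqSmallOn (omegaPlaqs Ω n) (r n) (γ x₀)) ∧ Sect2.CoDivClassOn Ω k ε (γ x₀)) :
    ∀ᶠ x in 𝓝 x₀, (∀ n, n ≤ k → PlaqSmallOn (omegaPlaqs Ω n) (r n) (γ x)) ∧ Sect2.CoDivClassOn Ω k ε (γ x) :=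
  (eventually_mem_class17 hγ h.1).and (eventually_coDivClassOn hγ h.2)

end Openness

section MinimalCritical

variable {F : T4Family} {N : ℕ} [NeZero N]

/-- ★ **«MINIMAL ⇒ CRITICAL» OVER THE (1.7)-CLASS** (def-R's `regMSOfRecord` reading of (2.12), ANY thresholds `r_n`, any determining set): a minimiser of
(5) over `{U | ∀ n ≤ k, |U(∂p) − 1| < r_n on omegaPlaqs Ω n}` on the fibre of `W` is a critical configuration of (5) on that fibre — a curve through it
differentiable at `0` is continuous there, so stays in the OPEN class, and Fermat applies. [cite: Balaban1985Variational, p.299 («minimal configuration»), p.300 (Sect. F); Balaban1988Convergent, (2.12) p.256] -/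
theorem isCritOnFibre_of_isMinimizer_class17 {K k : ℕ} {Ω : ℕ → Set (Site (F.P K) 0)} {r : ℕ → ℝ} {𝔹 : DetSet (F.P K)}
    {W : MSField (F.P K) (SU N)} {U₀ : GaugeField (F.P K) 0 (SU N)}
    (h : IsMinimizer (avOfRecord F N K) {U | ∀ n, n ≤ k → PlaqSmallOn (omegaPlaqs Ω n) (r n) U} 𝔹 W U₀) :
    IsCritOnFibre F N K 𝔹 W U₀ := by
  intro γ h0 hd hc a ha
  have hγ : ContinuousAt (fun t (b : PBond (F.P K) 0) => γ t b) 0 := continuousAt_of_differentiableAt_val hd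
  have hU : ∀ n, n ≤ k → PlaqSmallOn (omegaPlaqs Ω n) (r n) (γ 0) := by
    rw [h0]
    exact h.1
  exact deriv_wilsonAction4_eq_zero_of_isMinimizer h h0 (eventually_mem_class17 hγ hU) hc ha

/-- ★ **«MINIMAL ⇒ CRITICAL» OVER PRINT'S CLASS (6) = (1.7) ∧ (1.9)** (the class edition of director-ym №149 (3) ∕ №150, read as the literal; ANY
thresholds): a minimiser of (5) over (6) on the fibre of `W` is a critical configuration of (5) on that fibre — the hypothesis of Prop. 8.
[cite: Balaban1985Variational, (6) p.278, p.299 («minimal configuration»), Prop. 8 p.304; Balaban1985RegularSpaces, (1.7)–(1.9) p.77; Balaban1988Convergent, (2.12) p.256] -/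
theorem isCritOnFibre_of_isMinimizer_class6 {K k : ℕ} {Ω : ℕ → Set (Site (F.P K) 0)} {r : ℕ → ℝ} {ε : ℝ} {𝔹 : DetSet (F.P K)}
    {W : MSField (F.P K) (SU N)} {U₀ : GaugeField (F.P K) 0 (SU N)}
    (h : IsMinimizer (avOfRecord F N K) {U | (∀ n, n ≤ k → PlaqSmallOn (omegaPlaqs Ω n) (r n) U) ∧ Sect2.CoDivClassOn Ω k ε U} 𝔹 W U₀) :
    IsCritOnFibre F N K 𝔹 W U₀ := by
  intro γ h0 hd hc a ha
  have hγ : ContinuousAt (fun t (b : PBond (F.P K) 0) => γ t b) 0 := continuousAt_of_differentiableAt_val hd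
  have hU : (∀ n, n ≤ k → PlaqSmallOn (omegaPlaqs Ω n) (r n) (γ 0)) ∧ Sect2.CoDivClassOn Ω k ε (γ 0) := by
    rw [h0]
    exact h.1
  exact deriv_wilsonAction4_eq_zero_of_isMinimizer h h0 (eventually_mem_class6 hγ hU) hc ha

/-- **FILE 9's HYPOTHESIS PAIR** (`VariationalThm1RegSepPrintedCo`): a minimiser over the (1.7)-class that ALSO satisfies (1.9) at the class threshold
minimises over (6) (def-P11's `IsMinimizer.of_subset_of_mem`), hence is critical on the fibre. [cite: Balaban1985Variational, (6) p.278, p.299; Balaban1985RegularSpaces, (1.7)–(1.9) p.77] -/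
theorem isCritOnFibre_of_isMinimizer_of_coDivClassOn {K k : ℕ} {Ω : ℕ → Set (Site (F.P K) 0)} {r : ℕ → ℝ} {ε : ℝ} {𝔹 : DetSet (F.P K)}
    {W : MSField (F.P K) (SU N)} {U₀ : GaugeField (F.P K) 0 (SU N)}
    (h : IsMinimizer (avOfRecord F N K) {U | ∀ n, n ≤ k → PlaqSmallOn (omegaPlaqs Ω n) (r n) U} 𝔹 W U₀) (h9 : Sect2.CoDivClassOn Ω k ε U₀) :
    IsCritOnFibre F N K 𝔹 W U₀ :=
  isCritOnFibre_of_isMinimizer_class6 (r := r) (ε := ε)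
    (IsMinimizer.of_subset_of_mem (reg' := {U | (∀ n, n ≤ k → PlaqSmallOn (omegaPlaqs Ω n) (r n) U) ∧ Sect2.CoDivClassOn Ω k ε U})
      (fun _ hU => hU.1) ⟨h.1, h9⟩ h)

end MinimalCritical

/-! ## §3 ★★ [15] Proposition 8 p. 304 at the objects of record — the named fact, in the TWO-SIDED (C′) binder block — and the Theorem-1 sentences it yields -/

section NamedFactProp8

variable (F : T4Family) (N : ℕ) [NeZero N]

/-- ★★ **[15] PROPOSITION 8 (p. 304 [28]), AT THE OBJECTS OF RECORD** — *«There exists a positive, absolute constant a₅ such, that if U is a critical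
configuration of (5) in the space (6) with V satisfying (7), and if ε₀ ≦ a₅, then U belongs to the space (8).»* — a NAMED FACT (a `Prop`, NEVER
asserted; constants `B₃, a₀, a₁` as parameters, print: `B₃` «depends on d and L only» (Thm 1), `a₅` absolute), in FILE 8 v1.3 ∕ FILE 9 ∕ FILE 10's currency
with ONE MORE CLAUSE (C′ below): for a SEPARATED (2.18) index `s` ([6] (1.3)–(1.6), `Sect2.SeqSeparated ν.M₁ s`), per-scale thresholds `0 < δ_n ≤ a₁`,
`B₃δ_n ≤ ε₀ ≤ a₀`, comparable BOTH WAYS (`δ_n ≤ 2δ_{n+1}` AND `δ_{n+1} ≤ 2δ_n` — [III] (2.6)–(2.8) along a run read in both directions), a datum `W` with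
PRINT'S (7) on the CONCORD range (`Sect2.DataSmall7P`), and a configuration `U` of the class (6) at `ε₀` — (1.7) `|U(∂p) − 1| < ε₀η_n²` on
`omegaPlaqs s.Ω n` AND (1.9) `‖η(D^{η*}_U∂U)(b)‖ < ε₀η_n³` on `Sect2.omegaBonds s.Ω n`, every `n ≤ k` — lying ON THE FIBRE of `W` over the determining
set `genSet s.Ω k` ([III] (2.2), (2.10)) and CRITICAL for (5) on that fibre (`IsCritOnFibre`, §1): `U` lies in (8) — (1.7) at `B₃δ_n·η_n²` and (1.9) at
`B₃δ_n·η_n³`, every `n ≤ k`.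
WHY C′ (this seat's LOCATED-M4 «free δ₀», INBOX 2026-08-27 ≈08:40Z): the conclusion at `n = 0` reads `omegaPlaqs s.Ω 0 = univ` — EVERY fine plaquette
`< B₃δ₀` —, while the one-sided block of FILES 8–10 (`δ_n ≤ 2δ_{n+1}` only) bounds `δ₀` from above alone and the data hypothesis reads `δ₀` only on the
PINNED level-0 plaquettes; a datum trivial at level 0 and twisted at level 1 inside `Ω₁` then refutes every fact over that block for EVERY `B₃` (letting
`δ₀ ↓ 0`).  Print has ONE `ε₁` for all scales, so its level-0 demand inside `Ω₁` (`B₃ε₁`) is implied by the level-1 demand (`B₃ε₁L⁻²`); the per-scale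
reading keeps that implication exactly when `δ_{n+1} ≤ L²δ_n`, which C′ (`≤ 2δ_n ≤ L²δ_n`) supplies.
READING displayed: criticality in the CURVE form; print's Sect. F works with the (82) tangent form (`B11Eq81Expansion`), equal to the curve form where
the averaging of record is a submersion at `U` (GAP-STATED(submersion), ref-C READ-121 NOTE 2).
-- TODO(general form): ONE threshold ε₁ in print (the per-scale ∕ two-sided-comparable form is the reading [III] p. 259 invokes); general admissible
-- `{Ω_j}` ∕ `𝔅_k` of [6] Sect. A (here `𝔅_k = genSet s.Ω k` of a (2.18) index); print's hypothesis is (82)-criticality.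
[cite: Balaban1985Variational, Prop. 8 p.304, (5)–(8) pp.278–279, Sect. F pp.300–304; Balaban1985RegularSpaces, (1.3)–(1.9) p.77; Balaban1988Convergent, (2.2) p.255, (2.6)–(2.8) pp.255–256, (2.10)–(2.12) p.256] -/
def Prop8RegSepPrinted (B₃ a₀ a₁ : ℝ) : Prop :=
  ∀ (ν : Stage7Numerics) (M : ℕ) (g : ℕ → ℝ) (K k : ℕ) (s : SeqOfRecord F ν M g K k), Sect2.SeqSeparated ν.M₁ s → ∀ (ε₀ : ℝ) (δ : ℕ → ℝ),
    (∀ n, n ≤ k → 0 < δ n ∧ δ n ≤ a₁ ∧ B₃ * δ n ≤ ε₀) → (∀ n, n < k → δ n ≤ 2 * δ (n + 1)) → (∀ n, n < k → δ (n + 1) ≤ 2 * δ n) → ε₀ ≤ a₀ →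
    ∀ W : MSField (F.P K) (SU N), Sect2.DataSmall7P (avOfRecord F N K) s.Ω k δ W →
      ∀ U : GaugeField (F.P K) 0 (SU N), (∀ n, n ≤ k → PlaqSmallOn (omegaPlaqs s.Ω n) (ε₀ * (F.P K).eta n ^ 2) U) →
        Sect2.CoDivClassOn s.Ω k ε₀ U → AgreeOn (genSet s.Ω k) (avgFamily (avOfRecord F N K) U) W → IsCritOnFibre F N K (genSet s.Ω k) W U →
        (∀ n, n ≤ k → PlaqSmallOn (omegaPlaqs s.Ω n) (B₃ * δ n * (F.P K).eta n ^ 2) U) ∧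
          ∀ n, n ≤ k → Sect2.CoDivSmallOn (Sect2.omegaBonds s.Ω n) (B₃ * δ n * (F.P K).eta n ^ 3) U

variable {F N}

/-- The fact is ANTITONE in the ceilings `a₀`, `a₁` (they enter only as upper bounds; cf. FILE 10 `VariationalThm1RegSepCo6.of_le`).
[cite: Balaban1985Variational, Prop. 8 p.304 («if ε₀ ≦ a₅»; bookkeeping)] -/
theorem Prop8RegSepPrinted.of_le {B₃ a₀ a₀' a₁ a₁' : ℝ} (h : Prop8RegSepPrinted F N B₃ a₀ a₁) (ha₀ : a₀' ≤ a₀) (ha₁ : a₁' ≤ a₁) :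
    Prop8RegSepPrinted F N B₃ a₀' a₁' :=
  fun ν M g K k s hsep ε₀ δ hδ hcomp hcomp' hε₀ W h7 U h17 h19 hfib hcrit =>
    h ν M g K k s hsep ε₀ δ (fun n hn => ⟨(hδ n hn).1, (hδ n hn).2.1.trans ha₁, (hδ n hn).2.2⟩) hcomp hcomp' (hε₀.trans ha₀) W h7 U h17 h19 hfib hcrit

/-- ★★ **THE PRIMED-CLASS THEOREM-1 SENTENCE (director-ym №149 (3) ∕ №150) FROM PROPOSITION 8, in the C′ block**: for a separated index, thresholds
comparable both ways, a datum with print's (7) on the concord range, EVERY MINIMISER of (2.12) over PRINT'S CLASS (6) at `ε₀` (the literal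
`{U | (1.7) at ε₀η² ∧ (1.9) at ε₀η³}` = node00-def-R's `regMSCoOfRecord` reading, FILE 10's `VariationalThm1RegSepCo6` binder) on the fibre of `W` lies
in (8).  Proof: minimal over the open class (6) ⇒ critical on the fibre (§2) ⇒ Prop. 8.  This is print's own chain «U_k is a minimal configuration of the
functional A(U)» (p. 299) → Sect. F → Prop. 8, with the silent step a theorem.  (FILE 10's `VariationalThm1RegSepCo6` itself — the one-sided block — is
NOT derived: it is located-refutable, M4; its C′ re-type follows from this theorem by currying.)
[cite: Balaban1985Variational, Thm 1 (6)–(8) pp.278–279, p.299, Prop. 8 p.304; Balaban1985RegularSpaces, (1.7)–(1.9) p.77; Balaban1988Convergent, (2.6)–(2.8) pp.255–256, (2.12) p.256] -/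
theorem regular_of_isMinimizer_class6_of_prop8 {B₃ a₀ a₁ : ℝ} (h8 : Prop8RegSepPrinted F N B₃ a₀ a₁) (ν : Stage7Numerics) (M : ℕ)
    (g : ℕ → ℝ) (K k : ℕ) (s : SeqOfRecord F ν M g K k) (hsep : Sect2.SeqSeparated ν.M₁ s) (ε₀ : ℝ) (δ : ℕ → ℝ)
    (hδ : ∀ n, n ≤ k → 0 < δ n ∧ δ n ≤ a₁ ∧ B₃ * δ n ≤ ε₀) (hcomp : ∀ n, n < k → δ n ≤ 2 * δ (n + 1))
    (hcomp' : ∀ n, n < k → δ (n + 1) ≤ 2 * δ n) (hε₀ : ε₀ ≤ a₀)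
    (W : MSField (F.P K) (SU N)) (h7 : Sect2.DataSmall7P (avOfRecord F N K) s.Ω k δ W) {U₀ : GaugeField (F.P K) 0 (SU N)}
    (hU₀ : IsMinimizer (avOfRecord F N K)
      {U | (∀ n, n ≤ k → PlaqSmallOn (omegaPlaqs s.Ω n) (ε₀ * (F.P K).eta n ^ 2) U) ∧ Sect2.CoDivClassOn s.Ω k ε₀ U} (genSet s.Ω k) W U₀) :
    (∀ n, n ≤ k → PlaqSmallOn (omegaPlaqs s.Ω n) (B₃ * δ n * (F.P K).eta n ^ 2) U₀) ∧
      ∀ n, n ≤ k → Sect2.CoDivSmallOn (Sect2.omegaBonds s.Ω n) (B₃ * δ n * (F.P K).eta n ^ 3) U₀ :=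
  h8 ν M g K k s hsep ε₀ δ hδ hcomp hcomp' hε₀ W h7 U₀ hU₀.1.1 hU₀.1.2 hU₀.2.1 (isCritOnFibre_of_isMinimizer_class6 hU₀)

/-- ★★ **FILE 9's SENTENCE FROM PROPOSITION 8, in the C′ block**: a minimiser of (2.12) over the (1.7)-class at `ε₀` that ALSO satisfies (1.9) at `ε₀`
(the hypothesis pair of def-P11's `VariationalThm1RegSepPrintedCo` — HYP-AUDIT-13 row H4, def-R ANSWER-143: `h9` read AT THE MINIMISER) minimises over (6)
(`IsMinimizer.of_subset_of_mem`), hence is critical on the fibre (§2), and Prop. 8 applies.  (`VariationalThm1RegSepPrintedCo` itself — one-sided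
block — is NOT derived, M4.) [cite: Balaban1985Variational, Thm 1 (6)–(8) pp.278–279, p.299, Prop. 8 p.304; Balaban1985RegularSpaces, (1.7)–(1.9) p.77; Balaban1988Convergent, (2.6)–(2.8) pp.255–256] -/
theorem regular_of_isMinimizer_class17_of_coDivClassOn_of_prop8 {B₃ a₀ a₁ : ℝ} (h8 : Prop8RegSepPrinted F N B₃ a₀ a₁) (ν : Stage7Numerics) (M : ℕ)
    (g : ℕ → ℝ) (K k : ℕ) (s : SeqOfRecord F ν M g K k) (hsep : Sect2.SeqSeparated ν.M₁ s) (ε₀ : ℝ) (δ : ℕ → ℝ)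
    (hδ : ∀ n, n ≤ k → 0 < δ n ∧ δ n ≤ a₁ ∧ B₃ * δ n ≤ ε₀) (hcomp : ∀ n, n < k → δ n ≤ 2 * δ (n + 1))
    (hcomp' : ∀ n, n < k → δ (n + 1) ≤ 2 * δ n) (hε₀ : ε₀ ≤ a₀)
    (W : MSField (F.P K) (SU N)) (h7 : Sect2.DataSmall7P (avOfRecord F N K) s.Ω k δ W) {U₀ : GaugeField (F.P K) 0 (SU N)}
    (hU₀ : IsMinimizer (avOfRecord F N K) {U | ∀ n, n ≤ k → PlaqSmallOn (omegaPlaqs s.Ω n) (ε₀ * (F.P K).eta n ^ 2) U} (genSet s.Ω k) W U₀)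
    (h9 : Sect2.CoDivClassOn s.Ω k ε₀ U₀) :
    (∀ n, n ≤ k → PlaqSmallOn (omegaPlaqs s.Ω n) (B₃ * δ n * (F.P K).eta n ^ 2) U₀) ∧
      ∀ n, n ≤ k → Sect2.CoDivSmallOn (Sect2.omegaBonds s.Ω n) (B₃ * δ n * (F.P K).eta n ^ 3) U₀ :=
  h8 ν M g K k s hsep ε₀ δ hδ hcomp hcomp' hε₀ W h7 U₀ hU₀.1 h9 hU₀.2.1 (isCritOnFibre_of_isMinimizer_of_coDivClassOn hU₀ h9)

/-- **DEF-R'S BACKGROUND OF RECORD (FILE 16 `UbgMSOfRecord`, the (1.7)-class minimiser) IS IN (8) AT EVERY SCALE, FROM PROPOSITION 8** — FILE 9's supplier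
shape `plaqSmallOn_∕coDivSmallOn_UbgMSOfRecord_of_thm1RegSepPrintedCo` with ONE MORE numerics clause (`hcomp'`, C′): thresholds `cR·ε_n(g_n)` in the
window, print's (7) at the datum (`h7`), (1.9) at the minimiser (`h9`), solvable fibre (`hsol`, def-R `isMinimizer_UbgMSOfRecord`).
[cite: Balaban1985Variational, Prop. 8 p.304, Thm 1 (8) p.279; Balaban1988Convergent, (2.6)–(2.8) pp.255–256, (2.12) p.256] -/
theorem regular_UbgMSOfRecord_of_prop8 {B₃ a₀ a₁ : ℝ} (h8 : Prop8RegSepPrinted F N B₃ a₀ a₁) (ν : Stage7Numerics) (M : ℕ)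
    (g : ℕ → ℝ) (K k : ℕ) (cR : ℝ) (s : SeqOfRecord F ν M g K k) (hsep : Sect2.SeqSeparated ν.M₁ s)
    (hnum : ∀ n, n ≤ k → 0 < cR * epsOfRecord ν g n ∧ cR * epsOfRecord ν g n ≤ a₁ ∧ B₃ * (cR * epsOfRecord ν g n) ≤ ν.εreg) (ha₀ : ν.εreg ≤ a₀)
    (hcomp : ∀ n, n < k → cR * epsOfRecord ν g n ≤ 2 * (cR * epsOfRecord ν g (n + 1)))
    (hcomp' : ∀ n, n < k → cR * epsOfRecord ν g (n + 1) ≤ 2 * (cR * epsOfRecord ν g n))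
    {W : MSField (F.P K) (SU N)} (h7 : Sect2.DataSmall7P (avOfRecord F N K) s.Ω k (fun n => cR * epsOfRecord ν g n) W)
    (h9 : Sect2.CoDivClassOn s.Ω k ν.εreg (UbgMSOfRecord F N ν M g K k s W))
    (hsol : W ∈ solvableDom (avOfRecord F N K) (regMSOfRecord F N ν K k s.Ω) (genSet s.Ω k)) :
    (∀ n, n ≤ k → PlaqSmallOn (omegaPlaqs s.Ω n) (B₃ * (cR * epsOfRecord ν g n) * (F.P K).eta n ^ 2) (UbgMSOfRecord F N ν M g K k s W)) ∧
      ∀ n, n ≤ k → Sect2.CoDivSmallOn (Sect2.omegaBonds s.Ω n) (B₃ * (cR * epsOfRecord ν g n) * (F.P K).eta n ^ 3)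
        (UbgMSOfRecord F N ν M g K k s W) :=
  regular_of_isMinimizer_class17_of_coDivClassOn_of_prop8 h8 ν M g K k s hsep ν.εreg (fun n => cR * epsOfRecord ν g n) hnum hcomp hcomp' ha₀ W h7
    (isMinimizer_UbgMSOfRecord ν M g K k s hsol) h9

end NamedFactProp8

/-! ## §4 (v1.1, append-only)  The STEP form of the named fact: `1 ≤ k` (print's variational problems live at a genuine step)

LOCATED-M5 (this seat, self-located, INBOX 2026-08-27 ≈09:45Z).  At `k = 0` the tree's determining set is EMPTY (`genSet s.Ω 0 j = ∅` for every `j`: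
`gammaRegion Ω 0 0 = Ω 0 = ∅` by `Seq.Ω_off`), so the fibre of §3's `Prop8RegSepPrinted` is the whole configuration space and `δ 0` is bounded from above only
(no comparability clause is active at `k = 0`): the fact then says that EVERY unconstrained critical point of the Wilson action in the class (6) is
`B₃δ₀`-flat for arbitrarily small `δ₀` — refutable by any non-flat lattice Yang–Mills solution in the small class (a uniform abelian flux `2π/|T|²` through
one family of planes on a long torus; its kernel certificate needs the first variation of the Wilson action and is NOT filed here).  MINIMISER sentences
(def-P11's `VariationalThm1RegSepCo7`, FILE 11) are unaffected: an unconstrained minimiser in a class containing `1` is flat.  Print has no variational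
problem at step `0` ([15] Thm 1, `k ≥ 1`; at `k = 0` 𝔅₀ pins `U = V`), so the faithful repair is the binder `1 ≤ k` — `Prop8RegSepStep` below; §3's fact
implies it (`Prop8RegSepPrinted.toStep`), and the Theorem-1 sentence at a genuine step follows from it exactly as in §3. -/

section NamedFactProp8Step

variable (F : T4Family) (N : ℕ) [NeZero N]

/-- ★★ **[15] PROPOSITION 8 (p. 304), AT THE OBJECTS OF RECORD, AT A GENUINE STEP `k ≥ 1`** — §3's `Prop8RegSepPrinted` with the ONE extra binder
`1 ≤ k` (print's range: the variational problem (5)–(6) of the `k`-th step, `k ≥ 1`; the tree's `k = 0` fibre is unconstrained, LOCATED-M5): separated index,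
thresholds comparable both ways (C′), data with print's (7) on the concord range, every configuration of the class (6) at `ε₀` on the fibre of `W` that is a
critical configuration of (5) on that fibre lies in (8).  A `Prop`, NEVER asserted; constants as parameters.
-- TODO(general form): ONE threshold ε₁ in print; general admissible `{Ω_j}` ∕ `𝔅_k`; print's hypothesis is (82)-criticality (curve form here).
[cite: Balaban1985Variational, Prop. 8 p.304, (5)–(8) pp.278–279, Sect. F pp.300–304; Balaban1985RegularSpaces, (1.3)–(1.9) p.77; Balaban1988Convergent, (2.2) p.255, (2.6)–(2.8) pp.255–256, (2.10)–(2.12) p.256] -/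
def Prop8RegSepStep (B₃ a₀ a₁ : ℝ) : Prop :=
  ∀ (ν : Stage7Numerics) (M : ℕ) (g : ℕ → ℝ) (K k : ℕ) (s : SeqOfRecord F ν M g K k), Sect2.SeqSeparated ν.M₁ s → 1 ≤ k → ∀ (ε₀ : ℝ) (δ : ℕ → ℝ),
    (∀ n, n ≤ k → 0 < δ n ∧ δ n ≤ a₁ ∧ B₃ * δ n ≤ ε₀) → (∀ n, n < k → δ n ≤ 2 * δ (n + 1)) → (∀ n, n < k → δ (n + 1) ≤ 2 * δ n) → ε₀ ≤ a₀ →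
    ∀ W : MSField (F.P K) (SU N), Sect2.DataSmall7P (avOfRecord F N K) s.Ω k δ W →
      ∀ U : GaugeField (F.P K) 0 (SU N), (∀ n, n ≤ k → PlaqSmallOn (omegaPlaqs s.Ω n) (ε₀ * (F.P K).eta n ^ 2) U) →
        Sect2.CoDivClassOn s.Ω k ε₀ U → AgreeOn (genSet s.Ω k) (avgFamily (avOfRecord F N K) U) W → IsCritOnFibre F N K (genSet s.Ω k) W U →
        (∀ n, n ≤ k → PlaqSmallOn (omegaPlaqs s.Ω n) (B₃ * δ n * (F.P K).eta n ^ 2) U) ∧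
          ∀ n, n ≤ k → Sect2.CoDivSmallOn (Sect2.omegaBonds s.Ω n) (B₃ * δ n * (F.P K).eta n ^ 3) U

variable {F N}

/-- §3's fact implies the step form (it drops the hypothesis `1 ≤ k`). [cite: Balaban1985Variational, Prop. 8 p.304 (bookkeeping)] -/
theorem Prop8RegSepPrinted.toStep {B₃ a₀ a₁ : ℝ} (h : Prop8RegSepPrinted F N B₃ a₀ a₁) : Prop8RegSepStep F N B₃ a₀ a₁ :=
  fun ν M g K k s hsep _ => h ν M g K k s hsep

/-- The step form is antitone in the ceilings `a₀`, `a₁`. [cite: Balaban1985Variational, Prop. 8 p.304 (bookkeeping)] -/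
theorem Prop8RegSepStep.of_le {B₃ a₀ a₀' a₁ a₁' : ℝ} (h : Prop8RegSepStep F N B₃ a₀ a₁) (ha₀ : a₀' ≤ a₀) (ha₁ : a₁' ≤ a₁) :
    Prop8RegSepStep F N B₃ a₀' a₁' :=
  fun ν M g K k s hsep hk ε₀ δ hδ hcomp hcomp' hε₀ W h7 U h17 h19 hfib hcrit =>
    h ν M g K k s hsep hk ε₀ δ (fun n hn => ⟨(hδ n hn).1, (hδ n hn).2.1.trans ha₁, (hδ n hn).2.2⟩) hcomp hcomp' (hε₀.trans ha₀) W h7 U h17 h19 hfib hcrit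

/-- ★★ **THE CLASS-(6) THEOREM-1 SENTENCE AT A GENUINE STEP FROM PROPOSITION 8 (step form)**: for `k ≥ 1`, a separated index, thresholds comparable both
ways, a datum with print's (7) on the concord range, every minimiser of (2.12) over print's class (6) at `ε₀` on the fibre of `W` lies in (8) — minimal over
the open class ⇒ critical on the fibre (§2) ⇒ Prop. 8.  (The `k = 0` case of def-P11's `VariationalThm1RegSepCo7` is the flat unconstrained minimiser and
needs no Prop. 8; it is supplied Summit-side.) [cite: Balaban1985Variational, Thm 1 (6)–(8) pp.278–279, p.299, Prop. 8 p.304; Balaban1988Convergent, (2.6)–(2.8) pp.255–256, (2.12) p.256] -/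
theorem regular_of_isMinimizer_class6_of_prop8Step {B₃ a₀ a₁ : ℝ} (h8 : Prop8RegSepStep F N B₃ a₀ a₁) (ν : Stage7Numerics) (M : ℕ)
    (g : ℕ → ℝ) (K k : ℕ) (s : SeqOfRecord F ν M g K k) (hsep : Sect2.SeqSeparated ν.M₁ s) (hk : 1 ≤ k) (ε₀ : ℝ) (δ : ℕ → ℝ)
    (hδ : ∀ n, n ≤ k → 0 < δ n ∧ δ n ≤ a₁ ∧ B₃ * δ n ≤ ε₀) (hcomp : ∀ n, n < k → δ n ≤ 2 * δ (n + 1))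
    (hcomp' : ∀ n, n < k → δ (n + 1) ≤ 2 * δ n) (hε₀ : ε₀ ≤ a₀)
    (W : MSField (F.P K) (SU N)) (h7 : Sect2.DataSmall7P (avOfRecord F N K) s.Ω k δ W) {U₀ : GaugeField (F.P K) 0 (SU N)}
    (hU₀ : IsMinimizer (avOfRecord F N K)
      {U | (∀ n, n ≤ k → PlaqSmallOn (omegaPlaqs s.Ω n) (ε₀ * (F.P K).eta n ^ 2) U) ∧ Sect2.CoDivClassOn s.Ω k ε₀ U} (genSet s.Ω k) W U₀) :
    (∀ n, n ≤ k → PlaqSmallOn (omegaPlaqs s.Ω n) (B₃ * δ n * (F.P K).eta n ^ 2) U₀) ∧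
      ∀ n, n ≤ k → Sect2.CoDivSmallOn (Sect2.omegaBonds s.Ω n) (B₃ * δ n * (F.P K).eta n ^ 3) U₀ :=
  h8 ν M g K k s hsep hk ε₀ δ hδ hcomp hcomp' hε₀ W h7 U₀ hU₀.1.1 hU₀.1.2 hU₀.2.1 (isCritOnFibre_of_isMinimizer_class6 hU₀)

end NamedFactProp8Step

end Literature.MathematicalPhysics.QuantumFieldTheory.Balaban1983to89.Node00

end
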